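import Literature.IUT.HodgeTheaters.TemperedCoveringsCor23OfSpecialFibreDecompActGraph
import Literature.IUT.HodgeTheaters.TemperedCoveringsCor23iiiOfSpecialFibre
import Literature.IUT.HodgeTheaters.StableCurveTemperedDataOfSpecialFibreTower
import Literature.AnabelianGeometry.SemiGraphs.ProSigmaCompletionNormalCentralizer
import HarnessLib

/-!
# [IUTchI] Cor. 2.3 (iii)'s KER-LEVEL laws `hA`/`hB` from «(H′)» (non-trivial normal subgroups of pro-`Σ̂` completions of
# free groups have trivial centraliser) — row «KER-LEVEL-VIA-HPRIME» (a route that is NOT print's)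

Mochizuki, *Inter-universal Teichmüller theory I: construction of Hodge theaters*, kurims manuscript (May 2020), §2,
Cor. 2.3 (iii) p. 47, proof p. 48 l. 36 – p. 49 l. 32 (case (a): pro-`l` completions; case (b): "[Tama2], Theorem 0.2, (v)",
p. 49 l. 6–14) [cite: Mochizuki2012, Cor 2.3(iii) pp.47-49] (D-0012 claim key; series status DISPUTED; nothing of the series
is asserted here); [AbsAnab] Lemma 1.3.1 p. 15 («`Δ_X`, `Π_X` are slim») / [AbsTopI] Lemma 4.5 (i) p. 54 («free pro-`Σ`») / the
classical statement, Ribes–Zalesskii, *Profinite Groups* §8.6–8.7: non-trivial normal subgroups of free pro-`Σ` groups have trivial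
centralisers (per-source attributions as in abc-iut-w4-d044's upstream header) — the tree's kernel theorem «(H′)»
`IsProSigmaCompletion.centralizer_eq_bot_of_normal` (abc-iut-w4-d044, `ProSigmaCompletionNormalCentralizer.lean`, for `Σ`
UNBOUNDED) [cite: MochizukiAbsAnab2004, Lemma 1.3.1 p.15].

PROOF-ONLY (abc-iut cell; seat abc-iut-w4-d052 gen 6; L5-lead RULINGS #107 row «COR23-IV-HA-HB-BY-NAME», offered route
«KER-LEVEL-VIA-HPRIME»).  The laws `hA`/`hB` of every Cor. 2.3 closer at the genuine datum are the KER-LEVEL statements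
«every `α ∈ Δ̂_X` commuting with `(Ĵ_i ∩ Δ̂_X) ∩ Ker(Δ̂_X ↠ Π̂_𝔾)` lies in `Ĵ_i`» at the tower levels (abc-iut-w4-d058's
`TemperedCoveringsCor23KerLevelOfTower`), guarded by (a) `∃ l ∈ Σ̂ ∖ (Σ ∪ {p})` resp. (b) `Σ̂ = Primes`.  They are `ℍ`-free.
THIS FILE derives KER-LEVEL in the STRONG form «`α = 1`» at EVERY level — by a route different from print's — from:
(x) «`Δ̂_X` is a pro-`Σ′` completion of a NONABELIAN FREE group» (`IsProSigmaCompletion Σ′ ι`, `ι : Γ → Δ̂_X`; true for an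
AFFINE hyperbolic curve with `Σ′ = Primes` by Riemann existence / [SGA1] — a FACT-INSTANCE-shaped input NOT in the tree at the
datum; false as stated for PROPER `X`), (z) «`Σ′` unbounded», and (y) «`N_i := (Ĵ_i ∩ Δ̂_X) ∩ Ker(Δ̂_X ↠ Π̂_𝔾) ≠ 1`» (under the
guards `Σ̂ ⊋ Σ`: the pro-`l` part of a vertex group dies in the pro-`Σ` `𝔾`; with `Σ̂ = Σ` and good reduction the kernel is
trivial and KER-LEVEL FAILS — the guards are load-bearing): `N_i` is normal in `Δ̂_X` (tower law `LevelsNormal`; a kernel), so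
(H′) gives `Z_{Δ̂_X}(N_i) = 1`, and an `α` commuting with `N_i` is `1 ∈ Ĵ_i`.

* `kerLevel_of_isProSigmaCompletion_free` — generic over any `StableCurveTemperedData` and `Prop24Tower` with normal levels;
* `kerLevel_ofSpecialFibre_of_isProSigmaCompletion_free` — at the genuine datum / special-fibre tower (side conditions
  `Δ̂_X` closed, `Π̂_X` Hausdorff and totally disconnected DISCHARGED by abc-iut-L5's lemmas);
* `cor23_i_to_v_ofSpecialFibre_closureH_of_piData_of_mem_decompSubgroups_of_hPrime` — the Cor. 2.3 (i)–(v) block at the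
  record's `ℍ` with BOTH laws `hA`, `hB` DISCHARGED from (x)/(y)/(z): binders = the origin datum `P.ActGraphInduces`, the
  FACT-INSTANCE `hcoh`, and the three displayed inputs.

BINDER CENSUS of the (i)–(v) headline (classes of L5-lead RULINGS #101 (2) / #108): DATA = `X`, `d`, `S`, `Σ`/`Σ̂` + side
conditions, `TpH`, `hTpH`, `cuspMeetsH`, `T`, `P`, and (z) `hSig` («`Σ′` unbounded»; `Σ′ = Primes` in the [IUTchII] Cor. 2.4 (i)
application) · DATUM-INTERNAL = `h36`, `S.hyp`, origin datum `hind : P.ActGraphInduces` · FACT-INSTANCE = `hcoh` ([SemiAnbd]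
Ex. 2.10 coherence of `G^c`; (v) only) and, IN SHAPE, (x) `hΓ`/`hι` («`Δ̂_X` is a pro-`Σ′` completion of a nonabelian free group»
— Riemann existence / [SGA1 XIII] / the [AbsTopI] Lem. 4.5 (i) «free pro-`Σ`» family AT an AFFINE hyperbolic curve; [IUTchI]'s
`X_K`, a once-punctured elliptic curve, and its coverings `X̲_K`, `C_K` are affine; the statement is FALSE for a proper curve, whose
`Δ̂_X` is a surface group) · LAW = (y) `hK` («`N_i ≠ 1`»; needs the guards `Σ̂ ⊋ Σ` of Cor. 2.3 (iii) (a)/(b)).  GONE: `hA`, `hB`.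

HONEST LIMITS: not print's proof ((a) uses pro-`l` quotients of the components' decomposition groups, (b) [Tama2]); does NOT
cover finite `Σ̂` under guard (a) ((H′) needs arbitrarily large primes in `Σ′`); (x) and (y) are displayed hypotheses (GAP-LEDGER
rows G-w4d052-g6-2 / -3), not theorems; nothing here bears on [IUTchIII] Cor. 3.12 or asserts that abc is proved or refuted.
-/

noncomputable section

namespace Literature.IUT.HodgeTheaters

open _root_.Topology
open scoped Pointwise
open Literature.AnabelianGeometry.SemiGraphs
open Literature.AnabelianGeometry.SemiGraphs.SemiGraphOfAnabelioids (IsProSigmaCompletion)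
open Literature.AnabelianGeometry.SemiGraphs.SemiGraphOfAnabelioids.IsProSigmaCompletion (centralizer_eq_bot_of_normal)

namespace StableCurveTemperedData

universe u

/-! ### A. Generic: KER-LEVEL at normal tower levels from (H′) -/

section Generic

variable (D : StableCurveTemperedData.{u}) (T : D.Prop24Tower)

/-- **KER-LEVEL from (H′)**, generic: for a datum whose `Δ̂_X` is CLOSED in a Hausdorff totally disconnected (compact)
`Π̂_X` and is a pro-`Σ′` completion of a nonabelian free group with `Σ′` unbounded, and a tower with NORMAL levels whose
`N_i := (Ĵ_i ∩ Δ̂_X) ∩ Ker(Δ̂_X ↠ Π̂_𝔾)` are non-trivial: every `α ∈ Δ̂_X` commuting with `N_i` lies in `Ĵ_i` (indeed `α = 1`,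
`centralizer_eq_bot_of_normal`). [cite: MochizukiAbsAnab2004, Lemma 1.3.1 p.15] -/
theorem kerLevel_of_isProSigmaCompletion_free (hN : T.LevelsNormal) [T2Space D.PiHat]
    [TotallyDisconnectedSpace D.PiHat] (hΔc : IsClosed (D.DeltaHat : Set D.PiHat))
    {Γ : Type*} [Group Γ] [IsFreeGroup Γ] (hΓ : ∃ x y : Γ, x * y ≠ y * x) {Sig : Set ℕ}
    {ι : Γ →* D.DeltaHat} (hι : IsProSigmaCompletion Sig ι) (hSig : ∀ m : ℕ, ∃ q ∈ Sig, q.Prime ∧ m < q)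
    (hK : ∀ i, (T.Jhat i).subgroupOf D.DeltaHat ⊓ D.ρHat.ker ≠ ⊥) :
    ∀ (i : T.I) (a : D.DeltaHat),
      (∀ x ∈ (T.Jhat i).subgroupOf D.DeltaHat, x ∈ D.ρHat.ker → a * x = x * a) →
        a ∈ (T.Jhat i).subgroupOf D.DeltaHat := by
  intro i a ha
  haveI : CompactSpace D.DeltaHat := isCompact_iff_compactSpace.mp hΔc.isCompact
  haveI : ((T.Jhat i).subgroupOf D.DeltaHat).Normal := hN i
  haveI : ((T.Jhat i).subgroupOf D.DeltaHat ⊓ D.ρHat.ker).Normal := inferInstance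
  have hcent : a ∈ Subgroup.centralizer
      (((T.Jhat i).subgroupOf D.DeltaHat ⊓ D.ρHat.ker : Subgroup D.DeltaHat) : Set D.DeltaHat) := by
    rw [Subgroup.mem_centralizer_iff]
    intro x hx
    exact (ha x hx.1 hx.2).symm
  rw [centralizer_eq_bot_of_normal hΓ hι hSig _ (hK i), Subgroup.mem_bot] at hcent
  rw [hcent]
  exact Subgroup.one_mem _

end Generic

/-! ### B. At the genuine 𝔛-datum and its special-fibre tower -/

section Genuine

variable {p : ℕ} [Fact p.Prime] (X : TemperedCurve p) (d : X.GroupLevelData)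
  (S : SpecialFibreData (X.toTemperedArithmeticGroup d)) (h36 : S.Gc.Prop36Hypotheses)
  (Sigma SigmaHat : Set ℕ) (hsub : Sigma ⊆ SigmaHat) (hne : Sigma.Nonempty)
  (hprime : ∀ q ∈ SigmaHat, q.Prime) (hp : p ∉ Sigma)
  (TpH : Subgroup S.chart.G)
  (HatH : Subgroup (TemperedGraphGroupData.exists_completion_of_prop36 S.Gc h36 S.chart).choose)
  (hle : TpH.map (TemperedGraphGroupData.exists_completion_of_prop36 S.Gc h36
    S.chart).choose_spec.choose.toMonoidHom ≤ HatH)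
  (cuspMeetsH : {x : X.Pt // X.IsCusp x} → Prop)
  (T : SpecialFibreTower X.DeltaTemp)

/-- **KER-LEVEL at the genuine datum from (H′)**: the tower levels are normal (`towerOfSpecialFibreTower_levelsNormal`),
`Δ̂_X` is closed, `Π̂_X` Hausdorff and totally disconnected (abc-iut-L5's lemmas) — leaving exactly (x) the pro-`Σ′`-completion-
of-a-nonabelian-free-group structure of `Δ̂_X`, (z) `Σ′` unbounded, (y) `N_i ≠ 1`. [cite: Mochizuki2012, Cor 2.3(iii) pp.48-49] -/
theorem kerLevel_ofSpecialFibre_of_isProSigmaCompletion_free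
    {Γ : Type*} [Group Γ] [IsFreeGroup Γ] (hΓ : ∃ x y : Γ, x * y ≠ y * x) {Sig : Set ℕ}
    {ι : Γ →* (ofSpecialFibre X d S h36 Sigma SigmaHat hsub hne hprime hp TpH HatH hle cuspMeetsH).DeltaHat} (hι : IsProSigmaCompletion Sig ι)
    (hSig : ∀ m : ℕ, ∃ q ∈ Sig, q.Prime ∧ m < q)
    (hK : ∀ i, ((OfSpecialFibre.towerOfSpecialFibreTower X d T Sigma SigmaHat hsub hne hprime S h36 hp TpH HatH hle cuspMeetsH).Jhat i).subgroupOf (ofSpecialFibre X d S h36 Sigma SigmaHat hsub hne hprime hp TpH HatH hle cuspMeetsH).DeltaHat ⊓ (ofSpecialFibre X d S h36 Sigma SigmaHat hsub hne hprime hp TpH HatH hle cuspMeetsH).ρHat.ker ≠ ⊥) :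
    ∀ (i : ℕ) (a : (ofSpecialFibre X d S h36 Sigma SigmaHat hsub hne hprime hp TpH HatH hle cuspMeetsH).DeltaHat),
      (∀ x ∈ ((OfSpecialFibre.towerOfSpecialFibreTower X d T Sigma SigmaHat hsub hne hprime S h36 hp TpH HatH hle cuspMeetsH).Jhat i).subgroupOf (ofSpecialFibre X d S h36 Sigma SigmaHat hsub hne hprime hp TpH HatH hle cuspMeetsH).DeltaHat, x ∈ (ofSpecialFibre X d S h36 Sigma SigmaHat hsub hne hprime hp TpH HatH hle cuspMeetsH).ρHat.ker → a * x = x * a) →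
        a ∈ ((OfSpecialFibre.towerOfSpecialFibreTower X d T Sigma SigmaHat hsub hne hprime S h36 hp TpH HatH hle cuspMeetsH).Jhat i).subgroupOf (ofSpecialFibre X d S h36 Sigma SigmaHat hsub hne hprime hp TpH HatH hle cuspMeetsH).DeltaHat := by
  haveI := ofSpecialFibre_t2Space_piHat X d S h36 Sigma SigmaHat hsub hne hprime hp TpH HatH hle cuspMeetsH
  haveI := ofSpecialFibre_totallyDisconnectedSpace_piHat X d S h36 Sigma SigmaHat hsub hne hprime hp TpH HatH hle
    cuspMeetsH
  exact kerLevel_of_isProSigmaCompletion_free _ _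
    (OfSpecialFibre.towerOfSpecialFibreTower_levelsNormal X d T Sigma SigmaHat hsub hne hprime S h36 hp TpH HatH hle
      cuspMeetsH)
    (ofSpecialFibre_isClosed_deltaHat X d S h36 Sigma SigmaHat hsub hne hprime hp TpH HatH hle cuspMeetsH) hΓ hι hSig hK

end Genuine

/-! ### C. Cor. 2.3 (i)–(v) at the record's `ℍ` with `hA`, `hB` DISCHARGED from (x)/(y)/(z) -/

section Block

variable {p : ℕ} [Fact p.Prime] (X : TemperedCurve p) (d : X.GroupLevelData)
  (S : SpecialFibreData (X.toTemperedArithmeticGroup d)) (h36 : S.Gc.Prop36Hypotheses)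
  (Sigma SigmaHat : Set ℕ) (hsub : Sigma ⊆ SigmaHat) (hne : Sigma.Nonempty)
  (hprime : ∀ q ∈ SigmaHat, q.Prime) (hp : p ∉ Sigma)
  (TpH : Subgroup S.chart.G)
  (cuspMeetsH : {x : X.Pt // X.IsCusp x} → Prop)
  (T : SpecialFibreTower X.DeltaTemp)

/-- **[IUTchI] Cor. 2.3 (i)–(v) AS TYPED at the genuine datum for the record's `ℍ := P.H`, every
`Π^tp_ℍ ∈ decompSubgroups S.chart P.H`, with the KER-LEVEL laws `hA`, `hB` DISCHARGED via (H′)** — binders: the origin datum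
`hind : P.ActGraphInduces`, the FACT-INSTANCE `hcoh`, and the three displayed inputs (x) `hι` (pro-`Σ′` completion of a
nonabelian free group), (z) `hSig` (`Σ′` unbounded), (y) `hK` (`N_i ≠ 1`). [cite: Mochizuki2012, Cor 2.3 pp.47-50] -/
theorem cor23_i_to_v_ofSpecialFibre_closureH_of_piData_of_mem_decompSubgroups_of_hPrime
    (P : SpecialFibreTower.PiData X d S T) (hcoh : S.Gc.IsCoherent) (hTpH : TpH ∈ S.chart.decompSubgroups P.H)
    (hind : P.ActGraphInduces)
    {Γ : Type*} [Group Γ] [IsFreeGroup Γ] (hΓ : ∃ x y : Γ, x * y ≠ y * x) {Sig : Set ℕ}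
    {ι : Γ →* (ofSpecialFibre X d S h36 Sigma SigmaHat hsub hne hprime hp TpH
      ((TpH.map (TemperedGraphGroupData.exists_completion_of_prop36 S.Gc h36
        S.chart).choose_spec.choose.toMonoidHom).topologicalClosure) (Subgroup.le_topologicalClosure _) cuspMeetsH).DeltaHat}
    (hι : IsProSigmaCompletion Sig ι) (hSig : ∀ m : ℕ, ∃ q ∈ Sig, q.Prime ∧ m < q)
    (hK : ∀ i, ((OfSpecialFibre.towerOfSpecialFibreTower X d T Sigma SigmaHat hsub hne hprime S h36 hp TpH
        ((TpH.map (TemperedGraphGroupData.exists_completion_of_prop36 S.Gc h36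
        S.chart).choose_spec.choose.toMonoidHom).topologicalClosure) (Subgroup.le_topologicalClosure _)
        cuspMeetsH).Jhat i).subgroupOf
        (ofSpecialFibre X d S h36 Sigma SigmaHat hsub hne hprime hp TpH
      ((TpH.map (TemperedGraphGroupData.exists_completion_of_prop36 S.Gc h36
        S.chart).choose_spec.choose.toMonoidHom).topologicalClosure) (Subgroup.le_topologicalClosure _) cuspMeetsH).DeltaHat ⊓
        (ofSpecialFibre X d S h36 Sigma SigmaHat hsub hne hprime hp TpH
      ((TpH.map (TemperedGraphGroupData.exists_completion_of_prop36 S.Gc h36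
        S.chart).choose_spec.choose.toMonoidHom).topologicalClosure) (Subgroup.le_topologicalClosure _) cuspMeetsH).ρHat.ker ≠ ⊥) :
    ((ofSpecialFibre X d S h36 Sigma SigmaHat hsub hne hprime hp TpH
      ((TpH.map (TemperedGraphGroupData.exists_completion_of_prop36 S.Gc h36
        S.chart).choose_spec.choose.toMonoidHom).topologicalClosure) (Subgroup.le_topologicalClosure _) cuspMeetsH).Cor23i ∧
      (ofSpecialFibre X d S h36 Sigma SigmaHat hsub hne hprime hp TpH
      ((TpH.map (TemperedGraphGroupData.exists_completion_of_prop36 S.Gc h36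
        S.chart).choose_spec.choose.toMonoidHom).topologicalClosure) (Subgroup.le_topologicalClosure _) cuspMeetsH).Cor23ii ∧
      (ofSpecialFibre X d S h36 Sigma SigmaHat hsub hne hprime hp TpH
      ((TpH.map (TemperedGraphGroupData.exists_completion_of_prop36 S.Gc h36
        S.chart).choose_spec.choose.toMonoidHom).topologicalClosure) (Subgroup.le_topologicalClosure _) cuspMeetsH).Cor23iii ∧
      (ofSpecialFibre X d S h36 Sigma SigmaHat hsub hne hprime hp TpH
      ((TpH.map (TemperedGraphGroupData.exists_completion_of_prop36 S.Gc h36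
        S.chart).choose_spec.choose.toMonoidHom).topologicalClosure) (Subgroup.le_topologicalClosure _) cuspMeetsH).Cor23iv) ∧
      (ofSpecialFibre X d S h36 Sigma SigmaHat hsub hne hprime hp TpH
      ((TpH.map (TemperedGraphGroupData.exists_completion_of_prop36 S.Gc h36
        S.chart).choose_spec.choose.toMonoidHom).topologicalClosure) (Subgroup.le_topologicalClosure _) cuspMeetsH).Cor23v :=
  have hKL := kerLevel_ofSpecialFibre_of_isProSigmaCompletion_free X d S h36 Sigma SigmaHat hsub hne hprime hp TpH
    ((TpH.map (TemperedGraphGroupData.exists_completion_of_prop36 S.Gc h36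
      S.chart).choose_spec.choose.toMonoidHom).topologicalClosure) (Subgroup.le_topologicalClosure _) cuspMeetsH T hΓ hι
    hSig hK
  cor23_i_to_v_ofSpecialFibre_closureH_of_piData_of_mem_decompSubgroups_of_actGraphInduces X d S h36 Sigma SigmaHat hsub
    hne hprime hp TpH cuspMeetsH T P (fun _ => hKL) (fun _ => hKL) hcoh hTpH hind

end Block

end StableCurveTemperedData

end Literature.IUT.HodgeTheaters

end
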